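import Summits.ResolutionOfSingularities.ResolutionOfSingularities.Theorems.HilbertSamuelEliminationSigmaMaxModificationsCorridor3SigmaBoundaryCoincidence
import Summits.ResolutionOfSingularities.ResolutionOfSingularities.Theorems.HilbertSamuelEliminationSigmaMaxModificationsCorridor3SigmaMenuStrategy
import Literature.AlgebraicGeometry.Resolution.NuEliminationBoundaryNEReachable
import Literature.AlgebraicGeometry.Resolution.Principalization
import HarnessLib

/-!
# [OURS · L1 W4.2] σ-LAYER — `Corridor3SigmaBoundaryBPermissible`: THE RUN INVARIANT OF RECORD «every centre the policy blows up is `𝓑`-PERMISSIBLE for the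
# CURRENT boundary» over the Literature predicate `IsBPermissible` (CJS Def. 5.4 = F-91b's `step` hypothesis), its menu form, the step shape under it, the
# GLOBAL-vs-LOCAL reading of «`D ⊂ B`» for the σ-layer's centres, and the coincidence programme (R-iii) re-cut over it ((D1′) off-member law = named CA
# target, (D2′) on-member obligation) — res-L1-w42-plan-1 WORD 2026-08-27T16:10:27Z (o-D3), ADDENDUM 16:11:15Z, RULINGS v3.14-42 (KC), -43 (KJ), -44 (KP);
# crux chain w42 `SigmaMaxModifications` stmt-ResolutionOfSingularities-18506 / conjunct `SigmaMaxModificationsCorridor3` stmt-ResolutionOfSingularities-19249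

OURS (cell res-hironaka, slot W4.2; typer res-L1-type-o1 g10); NOT statements of H. Hironaka's manuscript [Hironaka2017] nor of [CossartJannsenSaito2020];
AI-typed, weaker than expert review. Helper VOCABULARY `--supports stmt-ResolutionOfSingularities-19249 --as helper` (counted 0). Additive over
`…SigmaBoundaryCoincidence` (p547994: `Boundary.MemberCoincides`, `StrategyE.IsTransformCoincidentOnE`), `…SigmaMenuStrategy` (p527045: `plusMenu`,
over res-type-067's `IntrinsicMenuPlusAt` / `menuCentre`), `…SigmaMenuDiscipline` (p526241: `CentreMenu`, `StateScopeE`, `IsDisciplinedBy[Over]`,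
`MenuClauseA`, `StrategyE.hybrid`) and res-lit-3's `Literature…NuEliminationBoundaryNEReachable` (p548977: `boundaryMember`,
`IsNormalCrossingWithBoundaryAt` = CJS Def. 5.2 at scheme level, `IsBPermissible` = Def. 5.4, `CJSReachableNE`).

## What and why

RULING v3.14-42 (KC): «the σ-layer REUSES lit-3's `IsNormalCrossingWithBoundaryAt` / `IsBPermissible` as THE n.c.-with-boundary predicate of record —
ONE predicate for F-91b's provenance class and for the run invariant». This file is that reuse.

* §1 **`StrategyE.IsBPermissibleOnE 𝒮 N ν σ`** (the obligation (o-D3): at every state of the scope, every step `σ` allows has a centre `C` with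
  `IsBPermissible C E` for the CURRENT boundary `E`), its menu-level form **`MenuClauseB M N ν 𝒮`** (sibling of `MenuClauseA`), and the glue (antitone in
  scope / strategy / menu, `hybrid`, «disciplined + `MenuClauseB` ⇒ invariant», «admissible + n.c. part ⇒ invariant»); at the EMPTY boundary the invariant is
  plain permissibility (`isBPermissible_nil_iff`) — from `E₀ = []` its content accrues with the boundary, nothing is smuggled in at the start.
* §2 ONE σE-STEP UNDER THE INVARIANT(S): `CanonicalNearStepσE.isBPermissible_centre`; with admissibility and transform-coincidence,
  **`CanonicalNearStepσE.cjs_step_shape`** — a blow-up in a `𝓑`-permissible centre inside the `ν`-stratum, boundary carried by CJS's complete transform: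
  the σ-layer's SHARE of the hypotheses of `CJSReachableNE.step` (history `O`, refined value `ν̃`, connectedness, `dim ≤ 2` are the consumer's, on its
  surface germ — idea-2's card S / r-73′ at `η_Γ`).
* §3 THE READING OF «`D ⊂ B`» ((KC) «is the global `B ≤ C` too narrow for reducible centres?»; RULING v3.14-43 (KJ): the Literature predicate v2 reads
  «`D ⊂ B_i` at `x`» STALK-LOCALLY, v1 p548977 read it globally). PROVED: every centre a `plusMenu`-disciplined policy names is `menuCentre Z`, `Z`
  IRREDUCIBLE (`plusMenu.isIrreducible_support`) — so (R1)'s `hirr` on `CJSReachableNE.step` is free for us — and for irreducible `Z ∋ x` the global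
  `B ≤ menuCentre Z` (⟺ `Z ⊆ V(B)`) IS the support-local reading near `x` (`le_menuCentre_iff_exists_nhds`); the global reading implies the stalk-local
  one (`stalkIdeal_mono`). The global reading is narrower ONLY for a DISCONNECTED centre in mixed position (the CJS fallback's «whole part» centres, tree
  `IsCanonicalStep`): `{x₁} ⊔ {x₂}`, `x₁` on an old member, `x₂` off it, is Def-5.4-permissible pointwise and fails the global test at `x₁`; v2 accepts it;
  transforms of such centres are read serialised per connected component (F-91 FLAG (iv), (R1)). This file consumes `IsBPermissible` BY NAME.
* §4 THE COINCIDENCE PROGRAMME (R-iii) OVER THE INVARIANT (WORD 16:10:27Z (D1)/(D2) as corrected by the typer's OBJECTION 16:19:32Z / ADDENDUM 16:11:15Z):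
  `IsTransformCoincidentOnE` = OFF-member half ∧ ON-member half (`isTransformCoincidentOnE_iff_off_and_on`). **(D1′) `OffMemberCoincidenceLaw W`** —
  NAMED CA TARGET, NOT proved here (owner res-D-pv-060, RULING v3.14-44 (KP)): permissible `C` with IRREDUCIBLE support, LOCALLY PRINCIPAL `B`, `¬ B ≤ C`
  ⇒ `B̃ = π^* B`. Route: on a chart `C = V(𝔭)`, `𝔭` prime, `B = (f)`, `f ∉ 𝔭`; normal flatness ⇒ `f` is a non-zero-divisor mod every `𝔭ⁿ`, `(𝔭ⁿ : f) = 𝔭ⁿ`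
  ⇒ on `A[𝔭/g]` the exceptional equation `g` is a non-zero-divisor mod `f` ⇒ `colon (π^*B) 𝓘_E = π^*B` ⇒ the saturation `strictTransformIdeal` is `π^*B`.
  Both side conditions are needed (a component of `C` inside `V(B)`: `B̃ ≠ π^*B` over it; `B = 𝔪 ⊋ 𝔭`: `B̃ = ⊤ ≠ π^*𝔪`). **(D2′)
  `StrategyE.IsOnMemberCoincidentOnE`** — the ON-member half STAYS AN OBLIGATION (factorisation `𝓘_E · B̃ = π^* B`, i.e. `in_C(b)` regular on `gr_C(𝒪_W)`;
  near-point theory; NOT implied by `𝓑`-permissibility: specimen `W = V(x³y − z³)` in `…SigmaBoundaryCoincidence`, whose second centre is not `ν`-near —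
  hence an obligation on the SCOPE). ASSEMBLY **`isTransformCoincidentOnE_of_isBPermissibleOnE`**: invariant + (D1′) on the scope's stages + irreducible
  centres (automatic for `plusMenu`-disciplined policies) + locally principal members (`MembersLocallyPrincipal`; the exceptional divisor is effective
  Cartier, `isLocallyPrincipal_comap_centre`; a coinciding old member's transform is locally principal by one chart computation, not proved here) + (D2′)
  ⇒ `IsTransformCoincidentOnE` (hence `E.next C = completeTransformList`, p547994).

Nothing here claims a row; every `def` is an obligation/target with its dischargers named. VACUITY: `IsBPermissibleOnE` asserts Def. 5.4 for every
allowed centre at every state in scope; at `E = []` it is permissibility (§1) — neither trivially true nor trivially false as typed.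
-/

noncomputable section

set_option linter.dupNamespace false -- mandated namespace of this single-conjunct summit

open CategoryTheory AlgebraicGeometry TopologicalSpace
open Summit.ResolutionOfSingularities.ResolutionOfSingularities.Theorems.CampaignW42
open Literature.AlgebraicGeometry.Resolution Literature.RingTheory.HilbertSamuel

namespace Summit.ResolutionOfSingularities.ResolutionOfSingularities.Theorems.SigmaMaxModificationsCorridor3.Sigma

universe u

/-! ## §1. The run invariant `IsBPermissibleOnE` and its menu-level form -/

section Invariant

variable {N : ℕ} {ν : ℕ → ℕ}

/-- [OURS · L1 W4.2] **`σ` BLOWS UP ONLY `𝓑`-PERMISSIBLE CENTRES ON THE SCOPE `𝒮`** (the run invariant (o-D3) of RULING v3.14-42 (KC), replacing the role of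
CJS's standing hypothesis «blow-up in a `𝓑`-permissible center» (LNM 2270 p. 72 (5.10), p. 91 L7) for OUR σ-runs; NOT a statement of the manuscript): at
every state `(W, L, P, E)` of the scope, every step `σ` allows has a centre `C` which is `𝓑`-PERMISSIBLE FOR THE CURRENT BOUNDARY `E`
(`Literature…IsBPermissible C E`: permissible, Def. 3.1 (2), and normal crossing with `E` at every point of `V(C)`, Def. 5.2 — members through the point
not containing `V(C)` are met transversally, scheme-theoretically, with the right codimension). Sibling of `IsAdmissibleStrategyOnE` (whose clause (a)(i)
it refines) and of `StrategyE.IsTransformCoincidentOnE`. [cite: CossartJannsenSaito2020, Def. 5.4 (LNM 2270, p. 68)] -/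
def StrategyE.IsBPermissibleOnE (𝒮 : StateScopeE.{u}) (N : ℕ) (ν : ℕ → ℕ) (σ : StrategyE.{u}) : Prop :=
  ∀ (W : Scheme.{u}) (hW : IsLocallyNoetherian W) (L : Labelling W) (P : Option (Pending W)) (E : Boundary W), 𝒮 W hW L P E →
    ∀ (C : W.IdealSheafData) (P' : Option (Pending (blowup C))), σ.step W hW N ν L P E C P' → IsBPermissible C E

/-- [OURS · L1 W4.2] **CLAUSE (B) FOR THE MENU `M` ON THE SCOPE `𝒮`** (sibling of `MenuClauseA`): at every state of the scope, every `M`-centre at a point of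
the `ν`-stratum is `𝓑`-permissible for the state's boundary. The form in which a TIER discharges the invariant (exact-group faces, surface-phase cures and
point steps, …: each says what its menu guarantees against the CURRENT members). NOT a statement of the manuscript.
[cite: CossartJannsenSaito2020, Def. 5.4 (LNM 2270, p. 68)] -/
def MenuClauseB (M : CentreMenu.{u}) (N : ℕ) (ν : ℕ → ℕ) (𝒮 : StateScopeE.{u}) : Prop :=
  ∀ (W : Scheme.{u}) (hW : IsLocallyNoetherian W) (L : Labelling W) (P : Option (Pending W)) (E : Boundary W), 𝒮 W hW L P E →
    ∀ (x : W), x ∈ Scheme.hsStratum W N ν → ∀ (C : W.IdealSheafData), M W E N ν x C → IsBPermissible C E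

variable {𝒮 𝒮' : StateScopeE.{u}} {σ π τ : StrategyE.{u}} {M M' : CentreMenu.{u}}

/-- The invariant at a state and a step: the centre is `𝓑`-permissible for the current boundary. [cite: CossartJannsenSaito2020, Def. 5.4] -/
theorem StrategyE.IsBPermissibleOnE.isBPermissible (h : σ.IsBPermissibleOnE 𝒮 N ν) {W : Scheme.{u}} {hW : IsLocallyNoetherian W} {L : Labelling W}
    {P : Option (Pending W)} {E : Boundary W} (hS : 𝒮 W hW L P E) {C : W.IdealSheafData} {P' : Option (Pending (blowup C))}
    (hstep : σ.step W hW N ν L P E C P') : IsBPermissible C E :=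
  h W hW L P E hS C P' hstep

/-- … in particular permissible (clause (a)(i) of admissibility). [cite: CossartJannsenSaito2020, Def. 5.4, Def. 3.1 (2)] -/
theorem StrategyE.IsBPermissibleOnE.isPermissible (h : σ.IsBPermissibleOnE 𝒮 N ν) {W : Scheme.{u}} {hW : IsLocallyNoetherian W} {L : Labelling W}
    {P : Option (Pending W)} {E : Boundary W} (hS : 𝒮 W hW L P E) {C : W.IdealSheafData} {P' : Option (Pending (blowup C))}
    (hstep : σ.step W hW N ν L P E C P') : IdealSheafData.IsPermissible C :=
  (h.isBPermissible hS hstep).isPermissible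

/-- … and normal crossing with the current boundary at every point of the centre. [cite: CossartJannsenSaito2020, Def. 5.2, Def. 5.4] -/
theorem StrategyE.IsBPermissibleOnE.isNormalCrossingWithBoundaryAt (h : σ.IsBPermissibleOnE 𝒮 N ν) {W : Scheme.{u}} {hW : IsLocallyNoetherian W}
    {L : Labelling W} {P : Option (Pending W)} {E : Boundary W} (hS : 𝒮 W hW L P E) {C : W.IdealSheafData} {P' : Option (Pending (blowup C))}
    (hstep : σ.step W hW N ν L P E C P') {x : W} (hx : x ∈ (C.support : Set W)) : IsNormalCrossingWithBoundaryAt C E x :=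
  (h.isBPermissible hS hstep).2 x hx

/-- Antitone in the scope. [folklore] -/
theorem StrategyE.IsBPermissibleOnE.mono (h : σ.IsBPermissibleOnE 𝒮 N ν)
    (h𝒮 : ∀ (W : Scheme.{u}) (hW : IsLocallyNoetherian W) (L : Labelling W) (P : Option (Pending W)) (E : Boundary W),
      𝒮' W hW L P E → 𝒮 W hW L P E) :
    σ.IsBPermissibleOnE 𝒮' N ν :=
  fun W hW L P E hS C P' hs => h W hW L P E (h𝒮 W hW L P E hS) C P' hs

/-- Antitone in the strategy: fewer steps, fewer obligations. [folklore] -/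
theorem StrategyE.IsBPermissibleOnE.of_le (h : σ.IsBPermissibleOnE 𝒮 N ν)
    (hle : ∀ (W : Scheme.{u}) (hW : IsLocallyNoetherian W) (L : Labelling W) (P : Option (Pending W)) (E : Boundary W) (C : W.IdealSheafData)
      (P' : Option (Pending (blowup C))), π.step W hW N ν L P E C P' → σ.step W hW N ν L P E C P') :
    π.IsBPermissibleOnE 𝒮 N ν :=
  fun W hW L P E hS C P' hs => h W hW L P E hS C P' (hle W hW L P E C P' hs)

/-- **The hybrid keeps the invariant when the policy and the fallback do** (a hybrid step is a policy step or a fallback step). [folklore] -/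
theorem StrategyE.IsBPermissibleOnE.hybrid (hπ : π.IsBPermissibleOnE 𝒮 N ν) (hτ : τ.IsBPermissibleOnE 𝒮 N ν) :
    (π.hybrid τ).IsBPermissibleOnE 𝒮 N ν := by
  intro W hW L P E hS C P' hs
  rcases StrategyE.hybrid_step_cases hs with h | h
  · exact hπ W hW L P E hS C P' h
  · exact hτ W hW L P E hS C P' h

/-- **ADMISSIBLE + THE NORMAL-CROSSING PART ⇒ THE INVARIANT** (admissibility already gives permissibility of every centre; what the invariant ADDS is
Def. 5.2 against the current members). [cite: CossartJannsenSaito2020, Def. 5.4] -/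
theorem isBPermissibleOnE_of_isAdmissible_of_nc (hadm : IsAdmissibleStrategyOnE 𝒮 N ν σ)
    (hnc : ∀ (W : Scheme.{u}) (hW : IsLocallyNoetherian W) (L : Labelling W) (P : Option (Pending W)) (E : Boundary W), 𝒮 W hW L P E →
      ∀ (C : W.IdealSheafData) (P' : Option (Pending (blowup C))), σ.step W hW N ν L P E C P' →
        ∀ x ∈ (C.support : Set W), IsNormalCrossingWithBoundaryAt C E x) :
    σ.IsBPermissibleOnE 𝒮 N ν :=
  fun W hW L P E hS C P' hs => ⟨((hadm W hW L P E hS).1 C P' hs).1, hnc W hW L P E hS C P' hs⟩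

/-- `MenuClauseB` is antitone in the menu and in the scope. [folklore] -/
theorem MenuClauseB.mono (h : MenuClauseB M' N ν 𝒮) (hM : ∀ W E x C, M W E N ν x C → M' W E N ν x C)
    (h𝒯 : ∀ W hW L P E, 𝒮' W hW L P E → 𝒮 W hW L P E) : MenuClauseB M N ν 𝒮' :=
  fun W hW L P E hT x hx C hC => h W hW L P E (h𝒯 W hW L P E hT) x hx C (hM W E x C hC)

/-- **A DISCIPLINED STRATEGY KEEPS THE INVARIANT when its menu satisfies clause (B) on the scope.** [cite: CossartJannsenSaito2020, Def. 5.4] -/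
theorem StrategyE.IsDisciplinedBy.isBPermissibleOnE (hσ : σ.IsDisciplinedBy M N ν) (hM : MenuClauseB M N ν 𝒮) : σ.IsBPermissibleOnE 𝒮 N ν := by
  intro W hW L P E hS C P' hstep
  obtain ⟨x, hx, hC⟩ := hσ W hW L P E C P' hstep
  exact hM W hW L P E hS x hx C hC

/-- **DISCIPLINED OVER A FALLBACK**: menu steps by clause (B), fallback steps by the fallback's own invariant. [cite: CossartJannsenSaito2020, Def. 5.4] -/
theorem isBPermissibleOnE_of_disciplinedByOver (hσ : StrategyE.IsDisciplinedByOver M N ν τ σ) (hM : MenuClauseB M N ν 𝒮)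
    (hτ : τ.IsBPermissibleOnE 𝒮 N ν) : σ.IsBPermissibleOnE 𝒮 N ν := by
  intro W hW L P E hS C P' hstep
  rcases hσ W hW L P E C P' hstep with ⟨x, hx, hC⟩ | h
  · exact hM W hW L P E hS x hx C hC
  · exact hτ W hW L P E hS C P' h

/-- **THE HYBRID OF A DISCIPLINED POLICY over a fallback keeping the invariant keeps it.** [cite: CossartJannsenSaito2020, Def. 5.4] -/
theorem isBPermissibleOnE_hybrid (hπ : π.IsDisciplinedBy M N ν) (hM : MenuClauseB M N ν 𝒮) (hτ : τ.IsBPermissibleOnE 𝒮 N ν) :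
    (π.hybrid τ).IsBPermissibleOnE 𝒮 N ν :=
  (hπ.isBPermissibleOnE hM).hybrid hτ

end Invariant

/-! ### At the empty boundary the invariant is permissibility -/

section Empty

variable {W : Scheme.{u}}

/-- **Normal crossing with the EMPTY boundary at `x` is regularity of `V(C)` at `x`** (Def. 5.2 with `𝓑(x) = ∅`: only the empty family of members is
tested, and it asks that `𝒪_{D,x}` be regular). [cite: CossartJannsenSaito2020, Def. 5.2 (LNM 2270, p. 67)] -/
theorem isNormalCrossingWithBoundaryAt_nil_iff (C : W.IdealSheafData) (x : W) :
    IsNormalCrossingWithBoundaryAt C ([] : Boundary W) x ↔ IsRegularLocalRing ((W.presheaf.stalk x) ⧸ stalkIdeal C x) := by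
  have he : C ⊔ (∅ : Finset ℕ).sup (boundaryMember ([] : Boundary W)) = C := by
    rw [Finset.sup_empty, sup_bot_eq]
  constructor
  · intro h
    have h0 := (h ∅ (fun i hi => absurd hi (Finset.notMem_empty i))).1
    rwa [he] at h0
  · intro hreg S hS
    rcases S.eq_empty_or_nonempty with rfl | ⟨i, hi⟩
    · rw [he, Finset.card_empty, Nat.cast_zero, add_zero]
      exact ⟨hreg, rfl⟩
    · exact absurd (hS i hi).1 (by simp [boundarySupports_of_length_le])

/-- **`𝓑`-PERMISSIBLE FOR THE EMPTY BOUNDARY IS PERMISSIBLE** (the regularity Def. 5.2 asks at `𝓑 = ∅` is the first conjunct of Def. 3.1 (2)). So from the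
scheme-side default `E₀ = []` the invariant `IsBPermissibleOnE` starts as clause (a)(i) of admissibility and acquires content member by member.
[cite: CossartJannsenSaito2020, Def. 5.4, Def. 3.1 (2)] -/
theorem isBPermissible_nil_iff (C : W.IdealSheafData) : IsBPermissible C ([] : Boundary W) ↔ IdealSheafData.IsPermissible C := by
  refine ⟨fun h => h.1, fun h => ⟨h, fun x hx => ?_⟩⟩
  rw [isNormalCrossingWithBoundaryAt_nil_iff]
  exact (h x hx).1

end Empty

/-! ## §2. One σE-step under the invariant(s) -/

section Steps

variable {N : ℕ} {ν : ℕ → ℕ} {𝒮 : StateScopeE.{u}} {σ : StrategyE.{u}}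

/-- **ONE σE-STEP UNDER THE INVARIANT: its centre is `𝓑`-permissible for the boundary of the stage it blows up.** [cite: CossartJannsenSaito2020, Def. 5.4] -/
theorem CanonicalNearStepσE.isBPermissible_centre {s s' : MarkedStageE.{u}} (hstep : CanonicalNearStepσE σ N ν s s')
    (hσ : σ.IsBPermissibleOnE 𝒮 N ν) (hs : 𝒮 s.W s.ln s.L s.P s.E) :
    ∃ (C : s.W.IdealSheafData) (P' : Option (Pending (blowup C))) (h : IsLocallyNoetherian (blowup C)) (x' : ↥(blowup C)),
      σ.step s.W s.ln N ν s.L s.P s.E C P' ∧ IsBPermissible C s.E ∧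
        s' = ⟨⟨blowup C, h, s.L.next (Scheme.hsStratum s.W N ν) C, P', x'⟩, s.E.next C⟩ := by
  obtain ⟨C, P', h, x', hst, -, -, -, rfl⟩ := hstep
  exact ⟨C, P', h, x', hst, hσ s.W s.ln s.L s.P s.E hs C P' hst, rfl⟩

/-- **THE CJS-STEP SHAPE OF A σE-STEP** under admissibility + the invariant + transform-coincidence on the scope: the step is a blow-up in a
`𝓑`-PERMISSIBLE centre contained in the `ν`-stratum, the marked point goes to a CLOSED point of the new `ν`-stratum over the old one, and the new
boundary IS CJS's COMPLETE TRANSFORM `{B₁', …, Bₙ', E}` of the old — the σ-layer's share of the hypotheses of `CJSReachableNE.step` (the history `O`, the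
refined value `ν̃ ∈ Σ^{O,max}`, connectedness and `dim ≤ 2` are the consumer's, on its surface germ). [cite: CossartJannsenSaito2020, Def. 5.4, Def. 5.7, «Theorem 6.6 Follows from This» (LNM 2270, p. 91 L7)] -/
theorem CanonicalNearStepσE.cjs_step_shape {s s' : MarkedStageE.{u}} (hstep : CanonicalNearStepσE σ N ν s s')
    (hadm : IsAdmissibleStrategyOnE 𝒮 N ν σ) (hB : σ.IsBPermissibleOnE 𝒮 N ν) (hT : σ.IsTransformCoincidentOnE 𝒮 N ν)
    (hs : 𝒮 s.W s.ln s.L s.P s.E) :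
    ∃ (C : s.W.IdealSheafData) (P' : Option (Pending (blowup C))) (h : IsLocallyNoetherian (blowup C)) (x' : ↥(blowup C)),
      σ.step s.W s.ln N ν s.L s.P s.E C P' ∧ IsBPermissible C s.E ∧ (C.support : Set s.W) ⊆ Scheme.hsStratum s.W N ν ∧
        (blowup.π C).base x' = s.pt ∧ IsClosed ({x'} : Set ↥(blowup C)) ∧ x' ∈ Scheme.hsStratum (blowup C) N ν ∧
        s' = ⟨⟨blowup C, h, s.L.next (Scheme.hsStratum s.W N ν) C, P', x'⟩, completeTransformList (blowup.π C) C s.E⟩ := by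
  obtain ⟨C, P', h, x', hst, hπ, hcl, hx', rfl⟩ := hstep
  have hc : s.E.Coincides C := hT s.W s.ln s.L s.P s.E hs C P' hst
  exact ⟨C, P', h, x', hst, hB s.W s.ln s.L s.P s.E hs C P' hst, ((hadm s.W s.ln s.L s.P s.E hs).1 C P' hst).2.1, hπ, hcl, hx',
    by rw [← Boundary.next_eq_completeTransformList_of_coincides hc]⟩

end Steps

/-! ## §3. The reading of «`D ⊂ B`»: global = local for the σ-layer's (irreducible) centres -/

section Reading

variable {W : Scheme.{u}}

/-- **Every member of the WIDER intrinsic menu is irreducible** (`closure {x}`, or an irreducible component of a cut of the `ν`-stratum).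
(067's `isIrreducible_of_mem_intrinsicMenuAt` is the §1-menu case.) [folklore] -/
theorem isIrreducible_of_mem_intrinsicMenuPlusAt {E : Boundary W} {N : ℕ} {ν : ℕ → ℕ} {x : W} {Z : Set W}
    (hZ : Z ∈ IntrinsicMenuPlusAt E N ν x) : IsIrreducible Z := by
  rcases hZ with h | ⟨_, _, _, _, hZK, _⟩
  · rw [Set.mem_singleton_iff.mp h]
    exact isIrreducible_singleton.closure
  · exact componentsIn.isIrreducible hZK

/-- **Every centre of the menu of record has IRREDUCIBLE support.** [folklore] -/
theorem plusMenu.isIrreducible_support {E : Boundary W} {N : ℕ} {ν : ℕ → ℕ} {x : W} {C : W.IdealSheafData} (h : plusMenu W E N ν x C) :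
    IsIrreducible (C.support : Set W) := by
  obtain ⟨⟨Z, hZ, rfl⟩, -⟩ := (plusMenu_iff E N ν x C).mp h
  rw [coe_support_menuCentre]
  exact isIrreducible_of_mem_intrinsicMenuPlusAt hZ

/-- **Every centre of a `plusMenu`-DISCIPLINED strategy has irreducible support.** [folklore] -/
theorem StrategyE.IsMenuDisciplined.isIrreducible_support {N : ℕ} {ν : ℕ → ℕ} {σ : StrategyE.{u}} (hσ : σ.IsMenuDisciplined N ν)
    {hW : IsLocallyNoetherian W} {L : Labelling W} {P : Option (Pending W)} {E : Boundary W} {C : W.IdealSheafData}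
    {P' : Option (Pending (blowup C))} (hstep : σ.step W hW N ν L P E C P') : IsIrreducible (C.support : Set W) := by
  obtain ⟨x, -, hC⟩ := hσ W hW L P E C P' hstep
  exact plusMenu.isIrreducible_support hC

/-- A topological lemma: an irreducible set which lies in a closed set NEAR ONE OF ITS POINTS lies in it. [folklore] -/
theorem subset_of_isPreirreducible_of_inter_subset {α : Type*} [TopologicalSpace α] {Z F U : Set α} (hZ : IsPreirreducible Z)
    (hF : IsClosed F) (hU : IsOpen U) (hne : (Z ∩ U).Nonempty) (hsub : Z ∩ U ⊆ F) : Z ⊆ F := by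
  intro y hy
  by_contra hyF
  obtain ⟨z, hzZ, hzU, hzF⟩ := hZ U Fᶜ hU hF.isOpen_compl hne ⟨y, hy, hyF⟩
  exact hzF (hsub ⟨hzZ, hzU⟩)

/-- **GLOBAL «`D ⊂ B`» = «`Z ⊆ V(B)`»** for a menu centre `D = V(menuCentre Z)` (reduced structure): `B ≤ menuCentre Z ↔ Z ⊆ V(B)` (Mathlib's Galois
connection `support ⊣ vanishingIdeal`). [folklore] -/
theorem le_menuCentre_iff_subset (B : W.IdealSheafData) (Z : Closeds W) : B ≤ menuCentre Z ↔ (Z : Set W) ⊆ (B.support : Set W) :=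
  Scheme.IdealSheafData.le_support_iff_le_vanishingIdeal.symm

/-- **GLOBAL = LOCAL for irreducible centres**: for `Z` irreducible and `x ∈ Z`, «`V(menuCentre Z) ⊂ V(B)`» globally (`B ≤ menuCentre Z`) iff `Z ⊆ V(B)`
NEAR `x`. Hence, for every centre a `plusMenu`-disciplined policy names (§3 above), the global reading of «`D ⊂ B`» (v1 of the Literature predicate, the
`principalStrictTransform` split, the ON-member / OFF-member split of `…SigmaBoundaryCoincidence`) names at `x` exactly the members CJS Def. 5.2 names there
(`𝓑(x, D)` read near `x`, support level). [folklore] -/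
theorem le_menuCentre_iff_exists_nhds (B : W.IdealSheafData) {Z : Closeds W} (hZ : IsIrreducible (Z : Set W)) {x : W} (hx : x ∈ (Z : Set W)) :
    B ≤ menuCentre Z ↔ ∃ U : Set W, IsOpen U ∧ x ∈ U ∧ (Z : Set W) ∩ U ⊆ (B.support : Set W) := by
  rw [le_menuCentre_iff_subset]
  refine ⟨fun h => ⟨Set.univ, isOpen_univ, Set.mem_univ x, fun y hy => h hy.1⟩, ?_⟩
  rintro ⟨U, hU, hxU, hsub⟩
  exact subset_of_isPreirreducible_of_inter_subset hZ.isPreirreducible B.support.isClosed hU ⟨x, hx, hxU⟩ hsub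

/-- The same for any centre with irreducible support which IS the reduced structure on its support (every menu centre: `C = menuCentre Z`,
`Z = V(C)`): `B ≤ C` iff `V(C) ⊆ V(B)` near a chosen point of `V(C)`. [folklore] -/
theorem plusMenu.le_iff_exists_nhds {E : Boundary W} {N : ℕ} {ν : ℕ → ℕ} {x : W} {C : W.IdealSheafData} (h : plusMenu W E N ν x C)
    (B : W.IdealSheafData) {y : W} (hy : y ∈ (C.support : Set W)) :
    B ≤ C ↔ ∃ U : Set W, IsOpen U ∧ y ∈ U ∧ (C.support : Set W) ∩ U ⊆ (B.support : Set W) := by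
  obtain ⟨⟨Z, hZ, rfl⟩, -⟩ := (plusMenu_iff E N ν x C).mp h
  rw [coe_support_menuCentre] at hy ⊢
  exact le_menuCentre_iff_exists_nhds B (isIrreducible_of_mem_intrinsicMenuPlusAt hZ) hy

end Reading

/-! ## §4. The coincidence programme (R-iii) over the invariant: (D1′) law, (D2′) obligation, assembly -/

section Coincidence

variable {N : ℕ} {ν : ℕ → ℕ}

/-- [OURS · L1 W4.2] **`σ` IS OFF-MEMBER COINCIDENT ON `𝒮`**: at every state of the scope and every allowed step with centre `C`, every member `B` of the
current boundary NOT containing the centre (`¬ B ≤ C`) coincides — `B̃ = π^* B` (`Boundary.memberCoincides_iff_of_not_le`). The half of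
`IsTransformCoincidentOnE` that (D1′) discharges. NOT a statement of the manuscript. [folklore] -/
def StrategyE.IsOffMemberCoincidentOnE (𝒮 : StateScopeE.{u}) (N : ℕ) (ν : ℕ → ℕ) (σ : StrategyE.{u}) : Prop :=
  ∀ (W : Scheme.{u}) (hW : IsLocallyNoetherian W) (L : Labelling W) (P : Option (Pending W)) (E : Boundary W), 𝒮 W hW L P E →
    ∀ (C : W.IdealSheafData) (P' : Option (Pending (blowup C))), σ.step W hW N ν L P E C P' →
      ∀ B ∈ E, ¬ B ≤ C → Boundary.MemberCoincides C B

/-- [OURS · L1 W4.2] **`σ` IS ON-MEMBER COINCIDENT ON `𝒮`** — THE (D2′) OBLIGATION: at every state of the scope and every allowed step with centre `C`,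
every member `B` CONTAINING the centre (`B ≤ C`) coincides, i.e. satisfies CJS's factorisation `𝓘_E · B̃ = π^* B` (`Boundary.memberCoincides_iff_of_le`),
i.e. the initial form of its local equation along `C` is `gr_C(𝒪_W)`-regular. Near-point theory; NOT implied by `𝓑`-permissibility (two-step specimen
`W = V(x³y − z³)` in `…SigmaBoundaryCoincidence`); it stays an obligation on the strategy AND the scope (`ν`-runs). NOT a statement of the manuscript.
[folklore] -/
def StrategyE.IsOnMemberCoincidentOnE (𝒮 : StateScopeE.{u}) (N : ℕ) (ν : ℕ → ℕ) (σ : StrategyE.{u}) : Prop :=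
  ∀ (W : Scheme.{u}) (hW : IsLocallyNoetherian W) (L : Labelling W) (P : Option (Pending W)) (E : Boundary W), 𝒮 W hW L P E →
    ∀ (C : W.IdealSheafData) (P' : Option (Pending (blowup C))), σ.step W hW N ν L P E C P' →
      ∀ B ∈ E, B ≤ C → Boundary.MemberCoincides C B

variable {𝒮 : StateScopeE.{u}} {σ : StrategyE.{u}}

/-- **Transform-coincidence = off-member half ∧ on-member half.** [folklore] -/
theorem StrategyE.isTransformCoincidentOnE_iff_off_and_on :
    σ.IsTransformCoincidentOnE 𝒮 N ν ↔ σ.IsOffMemberCoincidentOnE 𝒮 N ν ∧ σ.IsOnMemberCoincidentOnE 𝒮 N ν := by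
  constructor
  · intro h
    exact ⟨fun W hW L P E hS C P' hs B hB _ => h W hW L P E hS C P' hs B hB,
      fun W hW L P E hS C P' hs B hB _ => h W hW L P E hS C P' hs B hB⟩
  · rintro ⟨hoff, hon⟩ W hW L P E hS C P' hs B hB
    by_cases hle : B ≤ C
    · exact hon W hW L P E hS C P' hs B hB hle
    · exact hoff W hW L P E hS C P' hs B hB hle

/-- [OURS · L1 W4.2] **(D1′) THE OFF-MEMBER COINCIDENCE LAW ON `W`** — NAMED TARGET (commutative algebra; NOT proved here; replaces the role of CJS's remark
that the principal and the scheme-theoretic strict transform of a boundary member agree off the centre, for OUR non-embedded σ-runs; NOT a statement of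
the manuscript): for every PERMISSIBLE centre `C` on `W` with IRREDUCIBLE support and every LOCALLY PRINCIPAL `B` with `¬ B ≤ C`, the member transform of
record coincides with the principal strict transform — equivalently (`Boundary.memberCoincides_iff_of_not_le`) the saturated strict transform is the total
transform, `B̃ = π^* B`. Discharge route: normal flatness of `W` along `C` (inside `IsPermissible`) ⇒ on each affine chart, with `C = V(𝔭)`, `𝔭` prime,
`B = (f)`, `f ∉ 𝔭`: `(𝔭ⁿ : f) = 𝔭ⁿ` for all `n` ⇒ the exceptional equation is a non-zero-divisor mod `π^* f` on every chart `A[𝔭/g]` ⇒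
`colon (π^*B) 𝓘_E = π^*B` ⇒ `strictTransformIdeal = π^*B`. Both side conditions are necessary (module docstring §4). [folklore] -/
def OffMemberCoincidenceLaw (W : Scheme.{u}) : Prop :=
  ∀ (C B : W.IdealSheafData), IdealSheafData.IsPermissible C → IsIrreducible (C.support : Set W) → IsLocallyPrincipal B → ¬ B ≤ C →
    Boundary.MemberCoincides C B

/-- [OURS · L1 W4.2] **ALL MEMBERS LOCALLY PRINCIPAL on the scope** (the structural side condition of (D1′) as a scope property): at every state of `𝒮` every
member of the boundary is a locally principal ideal sheaf. From `E₀ = []` this is a run invariant under coincidence: the new member `C.comap (blowup.π C)`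
is effective Cartier (`isLocallyPrincipal_comap_centre`), and a coinciding old member is `principalStrictTransform` of a locally principal ideal —
`π^* B` off the member, `(π^* B : 𝓘_E)` with `𝓘_E · B' = π^* B` on it — whose local principality is one chart computation (`π^* b = e · b'`), a CA
lemma not proved here. NOT a statement of the manuscript. [cite: CossartJannsenSaito2020, Def. 5.1, (5.2)–(5.3) (LNM 2270, p. 67–68)] -/
def MembersLocallyPrincipal (𝒮 : StateScopeE.{u}) : Prop :=
  ∀ (W : Scheme.{u}) (hW : IsLocallyNoetherian W) (L : Labelling W) (P : Option (Pending W)) (E : Boundary W), 𝒮 W hW L P E →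
    ∀ B ∈ E, IsLocallyPrincipal B

/-- The newest member of `E.next C` — the exceptional divisor — is locally principal (effective Cartier). [folklore] -/
theorem isLocallyPrincipal_comap_centre {W : Scheme.{u}} (C : W.IdealSheafData) [IsLocallyNoetherian (blowup C)] :
    IsLocallyPrincipal (C.comap (blowup.π C)) :=
  (blowup.isBlowup C).isEffectiveCartier.isLocallyPrincipal

/-- **(D1′) DISCHARGES THE OFF-MEMBER HALF**: the invariant + the law on the scope's stages + irreducible centres + locally principal members ⇒
`IsOffMemberCoincidentOnE`. [folklore] -/
theorem StrategyE.IsBPermissibleOnE.isOffMemberCoincidentOnE (hB : σ.IsBPermissibleOnE 𝒮 N ν)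
    (hlaw : ∀ (W : Scheme.{u}) (hW : IsLocallyNoetherian W) (L : Labelling W) (P : Option (Pending W)) (E : Boundary W), 𝒮 W hW L P E →
      OffMemberCoincidenceLaw W)
    (hirr : ∀ (W : Scheme.{u}) (hW : IsLocallyNoetherian W) (L : Labelling W) (P : Option (Pending W)) (E : Boundary W), 𝒮 W hW L P E →
      ∀ (C : W.IdealSheafData) (P' : Option (Pending (blowup C))), σ.step W hW N ν L P E C P' → IsIrreducible (C.support : Set W))
    (hlp : MembersLocallyPrincipal 𝒮) : σ.IsOffMemberCoincidentOnE 𝒮 N ν :=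
  fun W hW L P E hS C P' hs B hBE hle =>
    hlaw W hW L P E hS C B (hB.isPermissible hS hs) (hirr W hW L P E hS C P' hs) (hlp W hW L P E hS B hBE) hle

/-- **ASSEMBLY — `IsTransformCoincidentOnE` FROM THE INVARIANT**: `𝓑`-permissible centres (the invariant of record) + (D1′) on the scope's stages +
irreducible centres (automatic for `plusMenu`-disciplined policies, §3) + locally principal members + the (D2′) on-member obligation ⇒ the boundary of
every step in scope is CJS's complete transform (`CanonicalNearStepσE.next_E_eq_completeTransformList`, p547994). [folklore] -/
theorem isTransformCoincidentOnE_of_isBPermissibleOnE (hB : σ.IsBPermissibleOnE 𝒮 N ν)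
    (hlaw : ∀ (W : Scheme.{u}) (hW : IsLocallyNoetherian W) (L : Labelling W) (P : Option (Pending W)) (E : Boundary W), 𝒮 W hW L P E →
      OffMemberCoincidenceLaw W)
    (hirr : ∀ (W : Scheme.{u}) (hW : IsLocallyNoetherian W) (L : Labelling W) (P : Option (Pending W)) (E : Boundary W), 𝒮 W hW L P E →
      ∀ (C : W.IdealSheafData) (P' : Option (Pending (blowup C))), σ.step W hW N ν L P E C P' → IsIrreducible (C.support : Set W))
    (hlp : MembersLocallyPrincipal 𝒮) (hon : σ.IsOnMemberCoincidentOnE 𝒮 N ν) : σ.IsTransformCoincidentOnE 𝒮 N ν :=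
  StrategyE.isTransformCoincidentOnE_iff_off_and_on.mpr ⟨hB.isOffMemberCoincidentOnE hlaw hirr hlp, hon⟩

/-- **The same for a `plusMenu`-DISCIPLINED policy** (irreducibility of the centres supplied by §3). [folklore] -/
theorem StrategyE.IsMenuDisciplined.isTransformCoincidentOnE (hσ : σ.IsMenuDisciplined N ν) (hB : σ.IsBPermissibleOnE 𝒮 N ν)
    (hlaw : ∀ (W : Scheme.{u}) (hW : IsLocallyNoetherian W) (L : Labelling W) (P : Option (Pending W)) (E : Boundary W), 𝒮 W hW L P E →
      OffMemberCoincidenceLaw W)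
    (hlp : MembersLocallyPrincipal 𝒮) (hon : σ.IsOnMemberCoincidentOnE 𝒮 N ν) : σ.IsTransformCoincidentOnE 𝒮 N ν :=
  isTransformCoincidentOnE_of_isBPermissibleOnE hB hlaw (fun _ _ _ _ _ _ _ _ hs => hσ.isIrreducible_support hs) hlp hon

end Coincidence

end Summit.ResolutionOfSingularities.ResolutionOfSingularities.Theorems.SigmaMaxModificationsCorridor3.Sigma

end
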